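import Summits.QuantumAdvantage.QuantumAdvantage.Theorems.CubicForrelationNearExactIsExactTwelveTypeO960Flat
import Summits.QuantumAdvantage.QuantumAdvantage.Theorems.NearExactIsExact.Negative.SmallCasesAnf

/-!
# Crux `CubicForrelation.NearExactIsExact` (stmt-QuantumAdvantage-14043) — n = 12 at `Φ = 932/1024`, type O with base set `960`: the base set meets
  every AFFINE flat `s ⊕ {a₀,…,a₆}^⊥` in a character sum `≡ 0 (mod 4)` (translation covariance of `to18_typeO_E960_flat5`)

Certificate seat `b2b-cforr-cert` (gen 18).  HONEST FRAMING: a kernel-checked structure lemma (standard axioms) for the open rung `932/1024` at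
`n = 12`; nothing is closed here, NO new value of `θ₁₂`.  NOT summit progress.

`to18_typeO_E960_flat5_affine`: if cubic `f, g` have `g` type O with base set `#E = 960` and `Φ(f,g) ≥ 932/1024`, then for every `s`, every
`a₀, …, a₆` and every `y`: `Σ_{x ∈ E, (s ⊕ x) ⊥ a₀…a₆} (−1)^{x·y} = 4m`.  Proof: the pair `(f(s ⊕ ·), ℓ_s ⊕ g)` is again such a pair
(`forrelation_affine`, `te_isDegLeFun_shift`; its `u` is `u(s ⊕ ·)`, its base set is `s ⊕ E`), and `to18_typeO_E960_flat5` applies to it.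
In particular (`y = 0`) `#(E ∩ F) ≡ 0 (mod 4)` for every affine flat `F = s ⊕ {a₀,…,a₆}^⊥` of dimension `≥ 5`.  Kasami–Tokura's normal form
`x₁(x₂x₃ + x₄x₅ + x₆x₇ + x₈x₉)` of a weight-`960` cubic (NOT in the tree) meets `span(e₁,…,e₅)` in `6` points; so, modulo that classification
step, NO cubic pair on 12 bits attains `932/1024` through a type-O side of base `960` (HOME/b2b-cforr-cert-g18/PLAN-N12-932.md).

References: Kasami–Tokura (1970); MacWilliams–Sloane (1977) Ch. 13 §3, Ch. 15.  Axioms: the standard three.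
-/

set_option linter.dupNamespace false -- D-0017: single-problem summit ⇒ `QuantumAdvantage.QuantumAdvantage` by design

noncomputable section

namespace Summit.QuantumAdvantage.QuantumAdvantage.Theorems.CubicForrelation.NearExactIsExact

open Finset
open Literature.Computability.QuantumComplexity
open Literature.Computability.QuantumComplexity.BuzetChailloux (bxor zeroVec bxor_bxor_cancel_left bxor_zeroVec zeroVec_bxor bxor_comm
  bxor_self twist_zeroVec_right twist_bxor_right)
open Literature.Computability.QuantumComplexity.DerivativeWalsh (W twist_bxor_left)
open Literature.Computability.QuantumComplexity.Simon (twist_eq_one_or)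
open Summit.QuantumAdvantage.QuantumAdvantage.Theorems.NearExactIsExact.Negative.SmallCases (forrelation_affine)
open Summit.QuantumAdvantage.QuantumAdvantage.Theorems.SignedCubicForrelationNotPrBPP (knf_isDegLeFun_ip)

/-- **Type O with `#E = 960` at `Φ ≥ 932/1024`: character sums of `E` over every AFFINE flat `s ⊕ {a₀,…,a₆}^⊥` are `≡ 0 (mod 4)`.**  See the
module docstring.  NOT summit progress. [this work] -/
theorem to18_typeO_E960_flat5_affine (f g : (Fin (6 + 6) → Bool) → Bool) (hf : IsDegLeFun 3 f) (hg : IsDegLeFun 3 g)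
    (u : (Fin (6 + 6) → Bool) → ℤ) (hu : ∀ x, W (fun y => signOf (g y)) x = (2 : ℝ) ^ 4 * (u x : ℝ))
    (hodd : ∃ x, Odd (u x)) (hE : #(univ.filter fun x : Fin (6 + 6) → Bool => (Odd (u x / 2) ↔ Odd (u x / 2 / 2))) = 960)
    (hΦ : (932 / 1024 : ℝ) ≤ forrelation f g) (s : Fin (6 + 6) → Bool) (a : Fin 7 → Fin (6 + 6) → Bool) (y : Fin (6 + 6) → Bool) :
    ∃ m : ℤ, ∑ x ∈ (univ.filter fun x : Fin (6 + 6) → Bool => (Odd (u x / 2) ↔ Odd (u x / 2 / 2))).filter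
        (fun x => ∀ i, twist (a i) (bxor s x) = 1), twist x y = 4 * (m : ℝ) := by
  classical
  set E := univ.filter (fun x : Fin (6 + 6) → Bool => (Odd (u x / 2) ↔ Odd (u x / 2 / 2))) with hEdef
  -- the translated pair
  set ℓ : (Fin (6 + 6) → Bool) → Bool := fun z => decide (Odd #(univ.filter fun i => z i && s i)) with hℓ
  have hℓs : ∀ z, signOf (ℓ z) = twist s z := fun z => by rw [twist_comm]; exact (vg_twist_eq_signOf z s).symm
  set g' : (Fin (6 + 6) → Bool) → Bool := fun z => ℓ z ^^ g z with hg'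
  set f' : (Fin (6 + 6) → Bool) → Bool := fun x => f (bxor s x) with hf'
  have hg'deg : IsDegLeFun 3 g' := bb_isDegLeFun_bxor ((knf_isDegLeFun_ip s).mono (by norm_num)) hg
  have hf'deg : IsDegLeFun 3 f' := te_isDegLeFun_shift hf s
  set u' : (Fin (6 + 6) → Bool) → ℤ := fun x => u (bxor s x) with hu'
  have hW' : ∀ x, W (fun z => signOf (g' z)) x = W (fun z => signOf (g z)) (bxor s x) := by
    intro x
    unfold W
    refine sum_congr rfl fun z _ => ?_
    simp only [g']
    rw [signOf_xor, hℓs z, twist_bxor_right, twist_comm s z]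
    ring
  have hu'W : ∀ x, W (fun z => signOf (g' z)) x = (2 : ℝ) ^ 4 * (u' x : ℝ) := fun x => by rw [hW' x, hu]
  have hodd' : ∃ x, Odd (u' x) := by
    obtain ⟨x₀, hx₀⟩ := hodd
    exact ⟨bxor s x₀, by simp only [u']; rw [bxor_bxor_cancel_left]; exact hx₀⟩
  have hE' : #(univ.filter fun x : Fin (6 + 6) → Bool => (Odd (u' x / 2) ↔ Odd (u' x / 2 / 2))) = 960 := by
    rw [← hE]
    refine card_nbij' (fun x => bxor s x) (fun x => bxor s x) (fun x hx => ?_) (fun x hx => ?_)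
      (fun x _ => bxor_bxor_cancel_left s x) (fun x _ => bxor_bxor_cancel_left s x)
    · rw [mem_coe, mem_filter] at hx ⊢; exact ⟨mem_univ _, hx.2⟩
    · rw [mem_coe, mem_filter] at hx ⊢
      refine ⟨mem_univ _, ?_⟩
      simp only [u']; rw [bxor_bxor_cancel_left]; exact hx.2
  have hΦ' : (932 / 1024 : ℝ) ≤ forrelation f' g' := by
    have h := forrelation_affine f' g ℓ s hℓs false
    have e1 : (fun z => xor (xor false (ℓ z)) (g z)) = g' := by funext z; simp [g']
    have e2 : (fun x => f' (bxor x s)) = f := by funext x; simp only [f']; rw [bxor_comm x s, bxor_bxor_cancel_left]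
    rw [e1, e2] at h
    rw [h]; simp [signOf]; exact hΦ
  obtain ⟨c₁, hc⟩ := to18_typeO_E960_flat5 f' g' hf'deg hg'deg u' hu'W hodd' hE' hΦ' 
  obtain ⟨m, hm⟩ := hc (bxor c₁ y) a
  rw [bxor_bxor_cancel_left] at hm
  -- reindex the sum over the translated base set
  have hre : ∑ x ∈ (univ.filter fun x : Fin (6 + 6) → Bool => (Odd (u' x / 2) ↔ Odd (u' x / 2 / 2))).filter
      (fun x => ∀ i, twist (a i) x = 1), twist x y =
      ∑ x ∈ E.filter (fun x => ∀ i, twist (a i) (bxor s x) = 1), twist (bxor s x) y := by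
    refine sum_nbij' (fun x => bxor s x) (fun x => bxor s x) (fun x hx => ?_) (fun x hx => ?_)
      (fun x _ => bxor_bxor_cancel_left s x) (fun x _ => bxor_bxor_cancel_left s x) (fun x _ => by rw [bxor_bxor_cancel_left])
    · rw [mem_filter, mem_filter] at hx
      rw [mem_filter, hEdef, mem_filter]
      refine ⟨⟨mem_univ _, ?_⟩, fun i => by rw [bxor_bxor_cancel_left]; exact hx.2 i⟩
      have := hx.1.2; simp only [u'] at this; exact this
    · rw [mem_filter, hEdef, mem_filter] at hx
      rw [mem_filter, mem_filter]
      refine ⟨⟨mem_univ _, ?_⟩, hx.2⟩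
      simp only [u']; rw [bxor_bxor_cancel_left]; exact hx.1.2
  rw [hre, sum_congr rfl fun x _ => twist_bxor_left s x y, ← mul_sum] at hm
  rcases twist_eq_one_or s y with h1 | h1
  · exact ⟨m, by rw [h1, one_mul] at hm; exact hm⟩
  · refine ⟨-m, ?_⟩
    rw [h1] at hm
    push_cast
    linarith

end Summit.QuantumAdvantage.QuantumAdvantage.Theorems.CubicForrelation.NearExactIsExact

end
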